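/-
Copyright (c) 2026 the pub-hodgecm-mathlib formalisation cell (harness21).  Prover seat hodgecm-mathlib-K2Liu-p13 (g0), Track B «K2-LIT»,
#184♮ = hLiu418 = `stmt-HodgeConjecture-24832`; Road I v3 organ U1-CT-ind STAGE 2 (Q2), file F4-1e (LEAD F0P6-plan (g14) 10:39:33Z «F4-1c → F4-2 → F4 → F5 → D-U1 stage 3 =»).
-/
import Summits.HodgeConjecture.HodgeConjecture.Theorems.K2LiuKlingenConjUnipotent   -- ★∕📤 F4-1d: `row_three_of_mem_klingen`, `col_zero_unitarity_of_mem_klingen`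
import HarnessLib

/-!
# Crux `HLiu418`, Road I v3, organ U1 stage 2 (Q2), file F4-1e: `N_Q` IS CUT OUT BY EQUATIONS AND IS NORMAL IN `Q` —
# `N_Q = {g ∈ U(J₄) : g e₀ = e₀, g|_{⟨e₁,e₂⟩} = 1}`, hence `q N_Q q⁻¹ = N_Q` for `q ∈ Q`

Cell `hodgecm-mathlib`, crux item hLiu418 = `stmt-HodgeConjecture-24832`; squad K2 ∕ K2Liu; LEAD F0P6-plan (g14), co-dealer K2E5-plan (g7); prover K2Liu-p13 (g0).
THEOREMS ONLY (no `def`, no instance, no notation, no named-fact hypothesis, no `sorry`); lane `--supports stmt-HodgeConjecture-24832 --as helper` (count-neutral).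
Generic commutative ring `R` with an involutive ring endomorphism `σ`.
* §1 **`eq_nKlingen_of_entries`**: a unitary `g` with first column `e₀` (`g₀₀ = 1`, `g₁₀ = g₂₀ = g₃₀ = 0`) and middle block `1` (`g₁₁ = g₂₂ = 1`, `g₁₂ = g₂₁ = 0`) IS
  `n_Q(g₀₃ + g₀₂ σ(g₀₁), g₀₂, g₀₁)` — unitarity against the antidiagonal form pins the last column (`g₁₃ = −σ g₀₂`, `g₂₃ = −σ g₀₁`, `g₃₃ = 1`, `σ g₀₃ + g₀₃ + g₀₂σg₀₁ + g₀₁σg₀₂ = 0`)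
  and ★ F4-1d `row_three_of_mem_klingen` the last row; so **`mem_klingenUnip_iff_entries`**: `N_Q` (★ F4-0 `klingenUnip`, defined as `{n_Q(y,z,t)}`) is cut out by
  these seven equations inside `U(J₄)`.
* §2 **`conj_mem_klingenUnip`: `q ∈ Q, n ∈ N_Q ⇒ q n q⁻¹ ∈ N_Q`** (the equations are checked on `q n q⁻¹` from the zero patterns of `q`, `q⁻¹` ∈ `Q` — first column and last row —
  and the shape of `n`): `N_Q ⊲ Q`.  This is what makes the `N_Q(𝔸)`-integral of a Siegel section through an identity-cell representative `Ψ(q)`, `q ∈ Q(L⁺)`, constant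
  (`f(Ψ(q) u h) = f(Ψ(q) h)`, file F4) and lets the Klingen Levi act on `N_Q(𝔸)` by conjugation (file F5).
[MoeglinWaldspurger1995 I.2.1 (`P = MN`)], [Xiong2013 §7 L. 7.1], [Casselman1980 §3], [Rogawski1990 §1.9].
HONEST LABEL.  Count-neutral helper: `HC_CM` is proved only modulo the 7 printed citations (2 remaining named inputs: hLiu418 = `stmt-HodgeConjecture-24832`,
h413 = `stmt-HodgeConjecture-24833`) until rung 0 closes.
-/

set_option autoImplicit false
set_option linter.dupNamespace false -- the mandated namespace repeats `HodgeConjecture.HodgeConjecture`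

noncomputable section

open scoped Matrix

namespace Summit.HodgeConjecture.HodgeConjecture.Cruxes.HLiu418.K2LiuKlingenUnipotentNormal

open Literature.NumberTheory.Automorphic
open Summit.HodgeConjecture.HodgeConjecture.Cruxes.HLiu418.K2LiuDoubledUTwoTwoBorelFrame
open Summit.HodgeConjecture.HodgeConjecture.Cruxes.HLiu418.K2LiuKlingenParabolicDefs
open Summit.HodgeConjecture.HodgeConjecture.Cruxes.HLiu418.K2LiuKlingenBruhatTwoCells (inv_apply_mul_apply_of_mem_klingen)
open Summit.HodgeConjecture.HodgeConjecture.Cruxes.HLiu418.K2LiuKlingenUnipotentDefs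
open Summit.HodgeConjecture.HodgeConjecture.Cruxes.HLiu418.K2LiuKlingenConjUnipotent (row_three_of_mem_klingen col_zero_unitarity_of_mem_klingen)

variable {R : Type*} [CommRing R] {σ : R →+* R}

/-! ## §1 `N_Q` is cut out by equations -/

/-- **a unitary matrix with first column `e₀` and middle block `1` IS a Klingen unipotent letter**: `g = n_Q(g₀₃ + g₀₂ σ(g₀₁), g₀₂, g₀₁)`.
[cite: MoeglinWaldspurger1995, I.2.1] [cite: Xiong2013, §7 Lemma 7.1] [cite: Rogawski1990, §1.9] -/
theorem eq_nKlingen_of_entries (hσ : ∀ x, σ (σ x) = x) {g : unitaryGroupOfForm σ ((StdForm.antidiagonal 4).over R)}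
    (h00 : ((g : GL (Fin 4) R) : Matrix (Fin 4) (Fin 4) R) 0 0 = 1) (h10 : ((g : GL (Fin 4) R) : Matrix (Fin 4) (Fin 4) R) 1 0 = 0)
    (h20 : ((g : GL (Fin 4) R) : Matrix (Fin 4) (Fin 4) R) 2 0 = 0) (h30 : ((g : GL (Fin 4) R) : Matrix (Fin 4) (Fin 4) R) 3 0 = 0)
    (h11 : ((g : GL (Fin 4) R) : Matrix (Fin 4) (Fin 4) R) 1 1 = 1) (h12 : ((g : GL (Fin 4) R) : Matrix (Fin 4) (Fin 4) R) 1 2 = 0)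
    (h21 : ((g : GL (Fin 4) R) : Matrix (Fin 4) (Fin 4) R) 2 1 = 0) (h22 : ((g : GL (Fin 4) R) : Matrix (Fin 4) (Fin 4) R) 2 2 = 1) :
    ∃ hy : σ (((g : GL (Fin 4) R) : Matrix (Fin 4) (Fin 4) R) 0 3 + ((g : GL (Fin 4) R) : Matrix (Fin 4) (Fin 4) R) 0 2 * σ (((g : GL (Fin 4) R) : Matrix (Fin 4) (Fin 4) R) 0 1)) =
        -(((g : GL (Fin 4) R) : Matrix (Fin 4) (Fin 4) R) 0 3 + ((g : GL (Fin 4) R) : Matrix (Fin 4) (Fin 4) R) 0 2 * σ (((g : GL (Fin 4) R) : Matrix (Fin 4) (Fin 4) R) 0 1)),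
      g = nKlingen R σ hσ (((g : GL (Fin 4) R) : Matrix (Fin 4) (Fin 4) R) 0 3 + ((g : GL (Fin 4) R) : Matrix (Fin 4) (Fin 4) R) 0 2 * σ (((g : GL (Fin 4) R) : Matrix (Fin 4) (Fin 4) R) 0 1))
        hy (((g : GL (Fin 4) R) : Matrix (Fin 4) (Fin 4) R) 0 2) (((g : GL (Fin 4) R) : Matrix (Fin 4) (Fin 4) R) 0 1) := by
  have hq : g ∈ klingen R σ := ⟨h10, h20, h30⟩
  obtain ⟨-, h31, h32⟩ := row_three_of_mem_klingen hσ hq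
  obtain ⟨-, -, e33⟩ := col_zero_unitarity_of_mem_klingen hq
  have h33 : ((g : GL (Fin 4) R) : Matrix (Fin 4) (Fin 4) R) 3 3 = 1 := by
    rw [h00, mul_one] at e33
    rw [← hσ (((g : GL (Fin 4) R) : Matrix (Fin 4) (Fin 4) R) 3 3), e33, map_one]
  -- the last column from unitarity at `(3,1)`, `(3,2)`, `(3,3)`
  have h := mem_unitaryGroupOfForm_iff.1 g.2
  have u31 : ((g : GL (Fin 4) R) : Matrix (Fin 4) (Fin 4) R) 0 1 + σ (((g : GL (Fin 4) R) : Matrix (Fin 4) (Fin 4) R) 2 3) = 0 := by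
    simpa [antidiagonal_over_four, antidiagFour, Matrix.mul_apply, Fin.sum_univ_four, h10, h20, h30, h31, h32, h33, h11, h12, h21, h22]
      using congrFun (congrFun h 3) 1
  have u32 : ((g : GL (Fin 4) R) : Matrix (Fin 4) (Fin 4) R) 0 2 + σ (((g : GL (Fin 4) R) : Matrix (Fin 4) (Fin 4) R) 1 3) = 0 := by
    simpa [antidiagonal_over_four, antidiagFour, Matrix.mul_apply, Fin.sum_univ_four, h10, h20, h30, h31, h32, h33, h11, h12, h21, h22]
      using congrFun (congrFun h 3) 2
  have h23 : ((g : GL (Fin 4) R) : Matrix (Fin 4) (Fin 4) R) 2 3 = -σ (((g : GL (Fin 4) R) : Matrix (Fin 4) (Fin 4) R) 0 1) := by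
    have := congrArg σ (eq_neg_of_add_eq_zero_right u31)
    rwa [hσ, map_neg] at this
  have h13 : ((g : GL (Fin 4) R) : Matrix (Fin 4) (Fin 4) R) 1 3 = -σ (((g : GL (Fin 4) R) : Matrix (Fin 4) (Fin 4) R) 0 2) := by
    have := congrArg σ (eq_neg_of_add_eq_zero_right u32)
    rwa [hσ, map_neg] at this
  have u33 : σ (((g : GL (Fin 4) R) : Matrix (Fin 4) (Fin 4) R) 0 3) + ((g : GL (Fin 4) R) : Matrix (Fin 4) (Fin 4) R) 0 3 +
      ((g : GL (Fin 4) R) : Matrix (Fin 4) (Fin 4) R) 0 2 * σ (((g : GL (Fin 4) R) : Matrix (Fin 4) (Fin 4) R) 0 1) +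
      ((g : GL (Fin 4) R) : Matrix (Fin 4) (Fin 4) R) 0 1 * σ (((g : GL (Fin 4) R) : Matrix (Fin 4) (Fin 4) R) 0 2) = 0 := by
    have e := congrFun (congrFun h 3) 3
    simp [antidiagonal_over_four, antidiagFour, Matrix.mul_apply, Fin.sum_univ_four, h33, h13, h23, hσ] at e
    linear_combination e
  refine ⟨?_, ?_⟩
  · rw [map_add, map_mul, hσ]
    linear_combination u33
  · apply ext_of_coe
    rw [coe_nKlingen]
    ext i j
    fin_cases i <;> fin_cases j <;> simp [nKlingenM, h00, h10, h20, h30, h11, h12, h21, h22, h31, h32, h33, h13, h23]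

/-- **`N_Q` IS CUT OUT BY EQUATIONS**: `g ∈ N_Q ↔ g₀₀ = 1 ∧ g₁₀ = g₂₀ = g₃₀ = 0 ∧ g₁₁ = g₂₂ = 1 ∧ g₁₂ = g₂₁ = 0` (the kernel of `Q → GL₁ × U(J₂)`).
[cite: MoeglinWaldspurger1995, I.2.1] [cite: Xiong2013, §7 Lemma 7.1] -/
theorem mem_klingenUnip_iff_entries (hσ : ∀ x, σ (σ x) = x) (g : unitaryGroupOfForm σ ((StdForm.antidiagonal 4).over R)) :
    g ∈ klingenUnip R σ hσ ↔
      ((g : GL (Fin 4) R) : Matrix (Fin 4) (Fin 4) R) 0 0 = 1 ∧ ((g : GL (Fin 4) R) : Matrix (Fin 4) (Fin 4) R) 1 0 = 0 ∧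
      ((g : GL (Fin 4) R) : Matrix (Fin 4) (Fin 4) R) 2 0 = 0 ∧ ((g : GL (Fin 4) R) : Matrix (Fin 4) (Fin 4) R) 3 0 = 0 ∧
      ((g : GL (Fin 4) R) : Matrix (Fin 4) (Fin 4) R) 1 1 = 1 ∧ ((g : GL (Fin 4) R) : Matrix (Fin 4) (Fin 4) R) 1 2 = 0 ∧
      ((g : GL (Fin 4) R) : Matrix (Fin 4) (Fin 4) R) 2 1 = 0 ∧ ((g : GL (Fin 4) R) : Matrix (Fin 4) (Fin 4) R) 2 2 = 1 := by
  constructor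
  · rintro ⟨y, hy, z, t, rfl⟩
    rw [coe_nKlingen]
    simp [nKlingenM]
  · rintro ⟨h00, h10, h20, h30, h11, h12, h21, h22⟩
    obtain ⟨hy, hg⟩ := eq_nKlingen_of_entries hσ h00 h10 h20 h30 h11 h12 h21 h22
    exact ⟨_, hy, _, _, hg⟩

/-! ## §2 `N_Q ⊲ Q` -/

/-- **`N_Q` IS NORMAL IN `Q`**: `q ∈ klingen`, `n ∈ klingenUnip` ⇒ `q n q⁻¹ ∈ klingenUnip`. [cite: MoeglinWaldspurger1995, I.2.1] [cite: Xiong2013, §7 Lemma 7.1] -/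
theorem conj_mem_klingenUnip (hσ : ∀ x, σ (σ x) = x) {q n : unitaryGroupOfForm σ ((StdForm.antidiagonal 4).over R)}
    (hq : q ∈ klingen R σ) (hn : n ∈ klingenUnip R σ hσ) : q * n * q⁻¹ ∈ klingenUnip R σ hσ := by
  have hqi : q⁻¹ ∈ klingen R σ := (klingen R σ).inv_mem hq
  obtain ⟨hi30, hi31, hi32⟩ := row_three_of_mem_klingen hσ hqi
  have hmem : q * n * q⁻¹ ∈ klingen R σ := (klingen R σ).mul_mem ((klingen R σ).mul_mem hq ((klingenUnip_le_klingen hσ) hn)) hqi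
  obtain ⟨n00, n10, n20, n30, n11, n12, n21, n22⟩ := (mem_klingenUnip_iff_entries hσ n).1 hn
  obtain ⟨-, n31, n32⟩ := row_three_of_mem_klingen hσ ((klingenUnip_le_klingen hσ) hn)
  obtain ⟨hq10, hq20, -⟩ := hq
  obtain ⟨hi10, hi20, -⟩ := hqi
  -- `q q⁻¹ = 1` read on entries
  have hqq : ((q : GL (Fin 4) R) : Matrix (Fin 4) (Fin 4) R) * (((q⁻¹ : unitaryGroupOfForm σ ((StdForm.antidiagonal 4).over R)) : GL (Fin 4) R) :
      Matrix (Fin 4) (Fin 4) R) = 1 := by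
    rw [← Units.val_mul, ← Subgroup.coe_mul, mul_inv_cancel, Subgroup.coe_one, Units.val_one]
  have hqq00 := congrFun (congrFun hqq 0) 0
  have hqq11 := congrFun (congrFun hqq 1) 1
  have hqq12 := congrFun (congrFun hqq 1) 2
  have hqq21 := congrFun (congrFun hqq 2) 1
  have hqq22 := congrFun (congrFun hqq 2) 2
  simp only [Matrix.mul_apply, Fin.sum_univ_four, hq10, hq20, hi10, hi20, hi30, hi31, hi32, zero_mul, mul_zero, add_zero, zero_add,
    Matrix.one_apply_eq, Matrix.one_apply_ne (by decide : (1 : Fin 4) ≠ 2), Matrix.one_apply_ne (by decide : (2 : Fin 4) ≠ 1)] at hqq00 hqq11 hqq12 hqq21 hqq22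
  refine (mem_klingenUnip_iff_entries hσ _).2 ⟨?_, hmem.1, hmem.2.1, hmem.2.2, ?_, ?_, ?_, ?_⟩ <;>
    simp only [Subgroup.coe_mul, Units.val_mul, Matrix.mul_apply, Fin.sum_univ_four, hq10, hq20, hi10, hi20, hi30, hi31, hi32,
      n00, n10, n20, n30, n11, n12, n21, n22, n31, n32, mul_zero, zero_mul, add_zero, zero_add, mul_one]
  · exact hqq00
  · exact hqq11
  · exact hqq12
  · exact hqq21
  · exact hqq22

end Summit.HodgeConjecture.HodgeConjecture.Cruxes.HLiu418.K2LiuKlingenUnipotentNormal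

end
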